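import Mathlib
import HarnessLib
import Summits.CriticalPhenomena.SAWScalingLimit.Theses.SAWDevelopingMap
import Literature.Probability.RandomPlanarGeometry.CurveTightness
import Literature.Probability.RandomPlanarGeometry.HexSAWStrip

/-!
Sketch for crux-ideate stmt-CriticalPhenomena-5423 (HexTight), ideator 3, round 1.
First lemmas of the two idea cards; nothing here is proved.
-/

namespace Summit.CriticalPhenomena.SAWScalingLimit.Cruxes.HexTight.Ideator3

open scoped BigOperators Topology ENNReal
open Filter Set MeasureTheory
open Literature.Probability.RandomPlanarGeometry
open Literature.Probability.LatticeModels

/-- Aizenman–Burchard hypothesis (H1) for the critical hexagonal SAW laws: a shell-dependent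
threshold `k`, constants `K ≥ 0`, `λ > 2`, `δ₀ > 0` with
`P_δ[k(x,ρ,R) separate traversals of D(x;ρ,R)] ≤ K (ρ/R)^λ` for `δ ∈ (0,δ₀]`, `δ ≤ ρ < R ≤ 1`
(the exact input of `isTightMeasureSet_of_traversalBounds`, written for `hexSAWLaw`). Card
`domination-buys-tightness` reaches it from Kemppainen–Smirnov's Condition C2; card
`rim-chords-price-one-pinch` reaches it by resampling inside discs. -/
def HexTraversalBound : Prop :=
  ∀ (D : DobrushinDomain) (a b : ℝ → HexVertex),
    SAW.IsEmbEndpointApprox hexGraph hexCenter D a b →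
    ∃ (k : ℂ → ℝ → ℝ → ℕ) (K lam δ₀ : ℝ), 0 ≤ K ∧ 2 < lam ∧ 0 < δ₀ ∧
      ∀ δ ∈ Set.Ioc (0 : ℝ) δ₀, ∀ (x : ℂ) (ρ R : ℝ), δ ≤ ρ → ρ < R → R ≤ 1 →
        SAW.hexSAWLaw D.carrier δ (a δ) (b δ)
          {γ | (⟨γ.walk.toCurve fun v => (δ : ℂ) * hexCenter v⟩ : Curve ℂ).HasTraversals (k x ρ R) x ρ R}
          ≤ ENNReal.ofReal (K * (ρ / R) ^ lam)

/-- FIRST LEMMA of card `domination-buys-tightness` (soft rung, provable now, size M):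
(H1) for `hexSAWLaw` implies the crux `HexTight` of the route file, by
`isTightMeasureSet_of_traversalBounds` (short-distance cutoff: a hexagonal polyline of mesh `δ`
cannot traverse a shell of inner radius `≤ δ` more than a bounded number of times; covering numbers
of `closure D.carrier`) and `isTightAlongMesh_of_isTightMeasureSet_image`
(`SAW.aemeasurable_embCurve`). -/
def TraversalBoundTight : Prop :=
  HexTraversalBound → Summit.CriticalPhenomena.SAWScalingLimit.Theses.SAWDevelopingMap.HexTight

/-- The random-walk excursion side of card `domination-buys-tightness`, on the honeycomb graph of
the discrete domain: the `3^{-|ω|}`-weighted mass of nearest-neighbour walks `z → w` of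
`hexDomainGraph Ω δ` avoiding a vertex set `F` (resp. avoiding `F` and hitting `S`). -/
noncomputable def rwMass (Ω : Set ℂ) (δ : ℝ) (z w : HexVertex) (F S : Set HexVertex)
    (hit : Bool) : ℝ≥0∞ :=
  ∑' ω : (SAW.hexDomainGraph Ω δ).Walk z w,
    Set.indicator {ω' | (∀ v ∈ ω'.support, v ∉ F) ∧ (hit = true → ∃ v ∈ ω'.support, v ∈ S)}
      (fun ω' => (3 : ℝ≥0∞)⁻¹ ^ ω'.length) ω

/-- Crux shape of card `domination-buys-tightness` — HEXAGONAL UNIFORM DOMINATION (the honeycomb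
transplant of `SAWBrownianDomination.UniformDomination`, weakened to an arbitrary modulus `ψ`):
there is `ψ : ℝ≥0∞ → ℝ≥0∞` with `ψ t → 0` as `t → 0` such that for every Jordan carrier, mesh,
lattice-connected forbidden set `F` (the support of a lattice walk `η`: the past), target `S` and
sites `z w`,
`P^{SAW}[hits S ∧ avoids F] · RW[avoids F] ≤ P^{SAW}[avoids F] · ψ(RW[hits S ∧ avoids F] / RW[avoids F])`
in cross-multiplied-free form below (the RW side is a probability in `[0,1]`, so we pass the
ratio to `ψ` directly). -/
def HexDomination : Prop :=
  ∃ ψ : ℝ≥0∞ → ℝ≥0∞, Tendsto ψ (𝓝[>] 0) (𝓝 0) ∧ Monotone ψ ∧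
    ∀ (J : JordanDomain) (δ : ℝ) (u v : HexVertex)
      (η : (SAW.hexDomainGraph J.carrier δ).Walk u v) (S : Set HexVertex) (z w : HexVertex),
      0 < δ →
      SAW.hexSAWLaw J.carrier δ z w
          {γ | (∀ x ∈ γ.walk.support, x ∉ (η.support : List HexVertex)) ∧
            ∃ x ∈ γ.walk.support, x ∈ S}
        ≤ SAW.hexSAWLaw J.carrier δ z w {γ | ∀ x ∈ γ.walk.support, x ∉ (η.support : List HexVertex)}
          * ψ (rwMass J.carrier δ z w {x | x ∈ η.support} S true
              / rwMass J.carrier δ z w {x | x ∈ η.support} S false)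

/-! ### Card `rim-chords-price-one-pinch`: the flat-sector first lemma -/

open SAW.HV in
/-- The `x_c`-mass of DEEP BOUNDARY BUBBLES of the strip domain `S_{T',L}`: self-avoiding mid-edge
walks from `a` that reach level `≥ 2T - 1` (depth `T` rows) and end on the `α`-dart at the vertex
`(1, 0, false)` or `(-1,0,false)` — the two boundary mid-edges of `α` adjacent to `a`. -/
noncomputable def deepBubble (T T' L : ℕ) : ℝ :=
  ∑ P ∈ (midWalks (stripV T' L)).filter (fun P => IsAlphaDart (finalDart P) ∧
      ((finalDart P).1.1 = 1 ∨ (finalDart P).1.1 = -1) ∧ ∃ v ∈ inner P, (2 * (T : ℤ) - 1 ≤ lev v)),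
    SAW.hexCriticalFugacity ^ mwLen P

/-- FIRST LEMMA of card `rim-chords-price-one-pinch` — BUBBLE BOUND ("price one pinch"): the
critical mass of boundary bubbles of depth `≥ T` returning NEXT TO their root decays polynomially
with an exponent beating the trivial rim-crossing count (`a > 1`; with the natural count of rim
crossings `a > 1/3` would do; the predicted value is the boundary two-leg exponent `a = 2`),
uniformly in the ambient strip: `∃ C, a > 1, ∀ T ≥ 1, ∀ T' ≥ T, ∀ L, deepBubble T T' L ≤ C · T^{-a}`.
(Free landing gives only `(A_∞ - A_T) = B_T / cos(3π/8) ≤ 100 T^{-10⁻¹⁰} / cos(3π/8)` by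
Krachun–Panagiotis; the card's route to `a > 1/3` is bridge decay with exponent near `1/4`
plus delocalisation of the landing point of deep arcs.) -/
def BubbleBound : Prop :=
  ∃ (C a : ℝ), 1 < a ∧ ∀ (T T' L : ℕ), 1 ≤ T → T ≤ T' →
    deepBubble T T' L ≤ C * (T : ℝ) ^ (-a)

end Summit.CriticalPhenomena.SAWScalingLimit.Cruxes.HexTight.Ideator3
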